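import Literature.NumberTheory.Transcendental.RoySmallValueGain
import Literature.NumberTheory.Transcendental.RoySmallValueLinearFactorsFintype
import Literature.NumberTheory.Transcendental.RoySmallValueFactorizationK
import Literature.NumberTheory.Transcendental.RoySmallValueVeronese
import HarnessLib

/-!
# Roy's small value estimate for `𝔾ₐ × 𝔾ₘ` — the leading constant of `Φ(P, Q, ·)` dominates the height of the zero-cycle

Topic `Literature/NumberTheory/Transcendental`. Part of the formalisation of the proof of Roy 2013,
Theorem 1.1 (named fact `roy2013_thm_1_1`, `RoySmallValueEstimates.lean`), seat B. Source: D. Roy,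
*A small value estimate for `𝔾ₐ × 𝔾ₘ`*, Mathematika 59 (2013) 333–363 = arXiv:1301.0663,
Proposition 2.3 (p. 7) and §6, (6.5) (p. 17):

> **Proposition 2.3.** [...] `F(P) = a ∏_{α∈Z} P(α)` [...] where the points are normalized to
> have norm 1 [...]. Then, `a` and `h(Z)` are related by `|log|a| − D h(Z)| ≤ 7 log(m+1) D deg(Z)`.

The lower bound `log|a| ≥ D h(Z) − …` is what makes the height of `Z` enter the small value
estimate with a favourable sign. In this development it is the parallel seat's "gain" inequality
`sum_mul_logHeight_le_sum_embeddings` (`RoySmallValueGain`): for `F₀ ∈ ℤ[r] ∖ 0` factoring over the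
number field `K` as `a ∏_j ℓ_j^{e_j}`, `ℓ_j = ∑_i c_{ji} r_i`,
`∑_j e_j h_K(c_j) ≤ ∑_{σ : K → ℂ} log(|σa| ∏_j (max_i |σ c_{ji}|)^{e_j})`. This file

* transports it from linearly ordered variable types to any finite type
  (`sum_mul_logHeight_le_sum_embeddings'`, by renaming as in `sum_mul_logHeight_le'`);
* specialises it to POINT forms `ℓ_{α_j}` (coefficient vector = Veronese vector of `α_j ∈ K³`),
  where `h_K(c_j) = D h_K(α_j)` (`logHeight_veronese`) and `max_ν |σ(α_j^ν)| = ‖σ ∘ α_j‖^D`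
  (`iSup_norm_veronese`): **`∑_j e_j D h_K(α_j) ≤ ∑_σ ( log|σ a| + D ∑_j e_j log ‖σ ∘ α_j‖ )`**
  (`sum_mul_height_le_sum_emb_veronese`) — with the points normalised to sup norm `1` in every
  embedding this is exactly `D·[K:ℚ]·h(Z) ≤ ∑_σ log|σ a|`, Roy's `D h(Z) ≤ log|a| + …` with the
  constant `7 log(m+1) D deg Z` improved to `0`.

Everything is proved; no definitions, no named facts.

## References

* [Roy2013] D. Roy, *A small value estimate for 𝔾ₐ × 𝔾ₘ*, Mathematika 59 (2013), 333–363
  (arXiv:1301.0663), Proposition 2.3 and §6, (6.5).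
-/

noncomputable section

open MvPolynomial NumberField Height Finset

namespace Literature.NumberTheory.Transcendental

namespace Roy2013

variable {K : Type*} [Field K] [NumberField K] {ι : Type*} [Fintype ι] {J : Type*} [Fintype J]

/-! ### Transport to an arbitrary finite variable type -/

/-- **The gain inequality for any finite variable type.**
[cite: Roy2013, Proposition 2.3 (`log|a| ≥ D h(Z) − 7 log(m+1) D deg Z`), here exact] -/
theorem sum_mul_logHeight_le_sum_embeddings' [Nonempty ι] {F₀ : MvPolynomial ι ℤ} (hF₀ : F₀ ≠ 0)
    {a : K} {c : J → ι → K} (hc : ∀ j, c j ≠ 0) {e : J → ℕ}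
    (hfac : map (Int.castRingHom K) F₀ = C a * ∏ j, (∑ i, C (c j i) * X i) ^ e j) :
    ∑ j, (e j : ℝ) * logHeight (c j) ≤
      ∑ σ : K →+* ℂ, Real.log (‖σ a‖ * ∏ j, (⨆ i, ‖σ (c j i)‖) ^ e j) := by
  classical
  obtain ⟨N, hN⟩ : ∃ N : ℕ, N = Fintype.card ι := ⟨_, rfl⟩
  obtain ⟨eq, -⟩ : ∃ _eq : ι ≃ Fin N, True := ⟨(Fintype.equivFin ι).trans (finCongr hN.symm), trivial⟩
  haveI : Nonempty (Fin N) := ⟨eq (Classical.arbitrary ι)⟩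
  obtain ⟨F₁, hF₁⟩ : ∃ F₁ : MvPolynomial (Fin N) ℤ, F₁ = rename eq F₀ := ⟨_, rfl⟩
  have hF₁0 : F₁ ≠ 0 := fun h => hF₀ (rename_injective _ eq.injective (by
    change rename eq F₀ = rename eq 0
    rw [map_zero, ← hF₁]; exact h))
  obtain ⟨c₁, hc₁def⟩ : ∃ c₁ : J → Fin N → K, c₁ = fun j k => c j (eq.symm k) := ⟨_, rfl⟩
  have hc₁ : ∀ j, c₁ j ≠ 0 := fun j h => hc j (by
    funext i
    have := congr_fun h (eq i)
    rw [hc₁def] at this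
    simpa using this)
  have hfac₁ : map (Int.castRingHom K) F₁ = C a * ∏ j, (∑ k, C (c₁ j k) * X k) ^ e j := by
    rw [hF₁, map_rename, hfac, map_mul, rename_C, map_prod]
    congr 1
    refine Finset.prod_congr rfl fun j _ => ?_
    rw [map_pow, map_sum]
    congr 1
    rw [← Fintype.sum_equiv eq.symm (fun k => C (c₁ j k) * X k) (fun i => rename eq (C (c j i) * X i))
      (fun k => by rw [map_mul, rename_C, rename_X, hc₁def, Equiv.apply_symm_apply])]
  have h := sum_mul_logHeight_le_sum_embeddings hF₁0 hc₁ hfac₁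
  have hh : ∀ j, logHeight (c₁ j) = logHeight (c j) := fun j => by
    rw [show c₁ j = c j ∘ eq.symm by rw [hc₁def]; rfl, logHeight_comp_equiv]
  have hsup : ∀ (σ : K →+* ℂ) j, (⨆ k, ‖σ (c₁ j k)‖) = ⨆ i, ‖σ (c j i)‖ := fun σ j => by
    rw [hc₁def]
    exact Equiv.iSup_congr eq.symm fun _ => rfl
  simp_rw [hh, hsup] at h
  exact h

/-! ### Point forms: the Veronese specialisation -/

/-- **`max_ν |z^ν| = (max_k |z_k|)^D`** for a complex point `z` and the monomials of degree `D`.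
[cite: Roy2013, Lemma 2.1 (comparison of heights in degree `D`)] -/
theorem iSup_norm_veronese {D : ℕ} (z : Fin 3 → ℂ) :
    (⨆ ν : CoefIdx D, ‖∏ k, z k ^ (ν.1 k)‖) = ‖z‖ ^ D := by
  classical
  haveI : Nonempty (CoefIdx D) := ⟨⟨Finsupp.single 0 D, single_mem_finsuppAntidiag 0⟩⟩
  have hnu : ∀ ν : CoefIdx D, ∑ k, ν.1 k = D := fun ν => (mem_finsuppAntidiag.mp ν.2).1
  refine le_antisymm (ciSup_le fun ν => ?_) ?_
  · rw [norm_prod]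
    calc ∏ k, ‖z k ^ (ν.1 k)‖ ≤ ∏ k, ‖z‖ ^ (ν.1 k) := by
          refine Finset.prod_le_prod (fun k _ => norm_nonneg _) fun k _ => ?_
          rw [norm_pow]
          exact pow_le_pow_left₀ (norm_nonneg _) (norm_le_pi_norm z k) _
      _ = ‖z‖ ^ D := by rw [Finset.prod_pow_eq_pow_sum, hnu]
  · -- a coordinate of maximal modulus
    obtain ⟨k₀, hk₀⟩ : ∃ k, ‖z‖ = ‖z k‖ := by
      have h := Pi.norm_def z
      obtain ⟨k, -, hk⟩ := Finset.exists_mem_eq_sup (univ : Finset (Fin 3)) univ_nonempty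
        (fun k => ‖z k‖₊)
      exact ⟨k, by rw [h, hk, coe_nnnorm]⟩
    have hle := le_ciSup (Finite.bddAbove_range fun ν : CoefIdx D => ‖∏ k, z k ^ (ν.1 k)‖)
      ⟨Finsupp.single k₀ D, single_mem_finsuppAntidiag k₀⟩
    refine le_trans (le_of_eq ?_) hle
    simp only [prod_pow_single, norm_pow, hk₀]

/-- **The gain for point forms**: if `F₀ ∈ ℤ[r] ∖ 0` factors over `K` as `a ∏_j ℓ_{α_j}^{e_j}`
with points `α_j ∈ K³ ∖ 0`, then
`∑_j e_j D h_K(α_j) ≤ ∑_{σ : K → ℂ} ( log|σ a| + D ∑_j e_j log ‖σ ∘ α_j‖ )`.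
[cite: Roy2013, Proposition 2.3 (`D h(Z) ≤ log|a| + 7 log(m+1) D deg Z`), here with constant `0`] -/
theorem sum_mul_height_le_sum_emb_veronese {D : ℕ} {F₀ : MvPolynomial (CoefIdx D) ℤ}
    (hF₀ : F₀ ≠ 0) {a : K} {α : J → Fin 3 → K} (hα0 : ∀ j, α j ≠ 0) {e : J → ℕ}
    (hfac : map (Int.castRingHom K) F₀ = C a * ∏ j, evalFormK D (α j) ^ e j) :
    ∑ j, (e j : ℝ) * (D * logHeight (α j)) ≤
      ∑ σ : K →+* ℂ, (Real.log ‖σ a‖ + D * ∑ j, (e j : ℝ) * Real.log ‖(σ ∘ α j : Fin 3 → ℂ)‖) := by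
  classical
  haveI : Nonempty (CoefIdx D) := ⟨⟨Finsupp.single 0 D, single_mem_finsuppAntidiag 0⟩⟩
  -- `a ≠ 0`
  have ha : a ≠ 0 := by
    rintro rfl
    rw [C_0, zero_mul] at hfac
    exact hF₀ (map_injective _ Int.cast_injective (by rw [hfac, map_zero]))
  -- the Veronese coefficient vectors
  have hver0 : ∀ j, (fun ν : CoefIdx D => ∏ k, α j k ^ (ν.1 k)) ≠ 0 := by
    intro j h
    obtain ⟨k, hk⟩ : ∃ k, α j k ≠ 0 := by
      by_contra h0
      exact hα0 j (funext fun k => by simpa using not_exists.mp h0 k)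
    have h1 := congrFun h ⟨Finsupp.single k D, single_mem_finsuppAntidiag k⟩
    rw [Pi.zero_apply, prod_pow_single] at h1
    exact pow_ne_zero D hk h1
  have h := sum_mul_logHeight_le_sum_embeddings' (K := K) hF₀
    (c := fun j (ν : CoefIdx D) => ∏ k, α j k ^ (ν.1 k)) hver0 (e := e) (a := a)
    (by rw [hfac]; rfl)
  -- left-hand side: Veronese heights
  have hL : ∀ j, logHeight (fun ν : CoefIdx D => ∏ k, α j k ^ (ν.1 k)) = D * logHeight (α j) :=
    fun j => logHeight_veronese (α j) (hα0 j)
  simp_rw [hL] at h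
  refine h.trans (le_of_eq (Finset.sum_congr rfl fun σ _ => ?_))
  -- right-hand side, embedding by embedding
  have hsup : ∀ j, (⨆ ν : CoefIdx D, ‖σ (∏ k, α j k ^ (ν.1 k))‖) = ‖(σ ∘ α j : Fin 3 → ℂ)‖ ^ D := by
    intro j
    have : ∀ ν : CoefIdx D, σ (∏ k, α j k ^ (ν.1 k)) = ∏ k, (σ ∘ α j) k ^ (ν.1 k) := fun ν => by
      simp only [map_prod, map_pow, Function.comp_apply]
    simp_rw [this]
    exact iSup_norm_veronese (σ ∘ α j)
  simp_rw [hsup]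
  have hpos : ∀ j, 0 < ‖(σ ∘ α j : Fin 3 → ℂ)‖ := by
    intro j
    obtain ⟨k, hk⟩ : ∃ k, α j k ≠ 0 := by
      by_contra h0
      exact hα0 j (funext fun k => by simpa using not_exists.mp h0 k)
    exact lt_of_lt_of_le (norm_pos_iff.mpr ((map_ne_zero σ).mpr hk)) (norm_le_pi_norm (σ ∘ α j) k)
  rw [Real.log_mul (norm_ne_zero_iff.mpr ((map_ne_zero σ).mpr ha))
    (prod_ne_zero_iff.mpr fun j _ => pow_ne_zero _ (pow_ne_zero _ (hpos j).ne')),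
    Real.log_prod (s := univ) (fun j _ => pow_ne_zero _ (pow_ne_zero _ (hpos j).ne')), mul_sum]
  congr 1
  refine Finset.sum_congr rfl fun j _ => ?_
  rw [← pow_mul, Real.log_pow, Nat.cast_mul]
  ring

end Roy2013

end Literature.NumberTheory.Transcendental
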